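import Summits.Ventures.PercRepro.KernelLaw3
import Summits.Ventures.PercRepro.LemmaC7

/-!
# Lemma C in the kernel: the class statistic `Z₃` computed by `decide`

The Lean statement `PercRepro.LemmaC` (p5, `LemmaC7.lean`) is the per-class inequality
`Z₃(u, m, v) ≥ 0` behind C-007.  This file gives it a **computable integer twin**
`classSumZ` — the same sum over the colourings `φ : u ∖ v → Fin 3` of the class, with the decidable
cell `cell3D` of `KernelLaw3.lean` and an integer copy `c007KernelZ` of the kernel — proves the twin
equal to the real-valued summand of `LemmaC` (`classSumZ_cast`), and then lets the kernel compute: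

* three class values of the triangle (`classSumZ_triangle_top_top_bot = 6`,
  `classSumZ_triangle_top_mid_bot = 6`, `classSumZ_triangle_top_bot_bot = 0`, the tight case),
  the numbers the census scripts print for these classes;
* `lemmaC_triangle_chains`: `Z₃ ≥ 0` on **every** chain `v ≤ m ≤ u` of the triangle with marks
  `0, 1, 2` (64 chains, 125 colouring evaluations, `decide +kernel`), transported to the exact
  body of `LemmaC` at `G = triangle` in `lemmaC_instance_triangle`.

So the Lean `LemmaC` and the enumerated `Z₃` are the same object: an instance of the former is
settled by kernel computation and agrees with the census values.
-/

namespace PercRepro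

namespace MultiGraph

variable {V E : Type*} (G : MultiGraph V E) [DecidableEq V] [Fintype V] [Fintype E]

omit [Fintype E] in
/-- The computable cell agrees with the classical one. -/
theorem cell3D_eq_triCell [DecidableEq E] [Fintype E] (a b c : V) (ω : Config E) :
    G.cell3D a b c ω = G.triCell a b c ω := by
  unfold cell3D triCell
  split_ifs <;> rfl

end MultiGraph

/-- Integer twin of the C-007 kernel `c007Kernel`. -/
def c007KernelZ : Fin 5 → Fin 5 → Fin 5 → ℤ :=
  ![![![0, 0, 0, 0, 2], ![0, 0, -1, -1, 0], ![0, -1, 0, -1, 0], ![0, -1, -1, 0, 0], ![2, 0, 0, 0, 2]],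
    ![![0, 0, -1, -1, 0], ![0, 0, 0, 0, 0], ![-1, 0, 0, -1, -1], ![-1, 0, -1, 0, -1], ![0, 0, -1, -1, 0]],
    ![![0, -1, 0, -1, 0], ![-1, 0, 0, -1, -1], ![0, 0, 0, 0, 0], ![-1, -1, 0, 0, -1], ![0, -1, 0, -1, 0]],
    ![![0, -1, -1, 0, 0], ![-1, 0, -1, 0, -1], ![-1, -1, 0, 0, -1], ![0, 0, 0, 0, 0], ![0, -1, -1, 0, 0]],
    ![![2, 0, 0, 0, 2], ![0, 0, -1, -1, 0], ![0, -1, 0, -1, 0], ![0, -1, -1, 0, 0], ![2, 0, 0, 0, 0]]]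

/-- The integer kernel casts to the real one. -/
theorem c007KernelZ_cast (i j k : Fin 5) : ((c007KernelZ i j k : ℤ) : ℝ) = c007Kernel i j k := by
  fin_cases i <;> fin_cases j <;> fin_cases k <;> simp [c007KernelZ, c007Kernel]

section Graph

variable {V E : Type*} [DecidableEq V] [Fintype V] [Fintype E] [DecidableEq E]

/-- **Computable class statistic** `Z₃(u, m, v)`: the C-007 kernel summed over the colourings
`φ : u ∖ v → Fin 3` of the class, with the computable cells. -/
def classSumZ (G : MultiGraph V E) (a b c : V) (u m v : Config E) : ℤ :=
  ∑ φ : ↥(openEdges u \ openEdges v) → Fin 3,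
    c007KernelZ (G.cell3D a b c (tripleCopy v m (openEdges u \ openEdges v) φ 0))
      (G.cell3D a b c (tripleCopy v m (openEdges u \ openEdges v) φ 1))
      (G.cell3D a b c (tripleCopy v m (openEdges u \ openEdges v) φ 2))

/-- The computable statistic is the real-valued colouring sum of `LemmaC`. -/
theorem classSumZ_cast (G : MultiGraph V E) (a b c : V) (u m v : Config E) :
    ((classSumZ G a b c u m v : ℤ) : ℝ) =
      ∑ φ : ↥(openEdges u \ openEdges v) → Fin 3,
        c007Kernel (G.triCell a b c (tripleCopy v m (openEdges u \ openEdges v) φ 0))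
          (G.triCell a b c (tripleCopy v m (openEdges u \ openEdges v) φ 1))
          (G.triCell a b c (tripleCopy v m (openEdges u \ openEdges v) φ 2)) := by
  unfold classSumZ
  push_cast
  refine Finset.sum_congr rfl fun φ _ => ?_
  rw [c007KernelZ_cast, G.cell3D_eq_triCell, G.cell3D_eq_triCell, G.cell3D_eq_triCell]

end Graph

namespace Examples

/-- The class `(111, 111, 000)` of the triangle (every edge a double): `Z₃ = 6` — the three
one-colour colourings give `{⊤, ⊤, ⊥}` (`+2` each), every other colouring `0`. -/
theorem classSumZ_triangle_top_top_bot :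
    classSumZ triangle 0 1 2 (fun _ => true) (fun _ => true) (fun _ => false) = 6 := by
  decide +kernel

/-- The class `(111, 110, 000)` of the triangle (edges `01`, `02` double, `12` single):
`Z₃ = 12 − 6 = 6`. -/
theorem classSumZ_triangle_top_mid_bot :
    classSumZ triangle 0 1 2 (fun _ => true) ![true, true, false] (fun _ => false) = 6 := by
  decide +kernel

/-- The class `(111, 000, 000)` of the triangle (every edge a single: each copy gets the edges of
its colour): `Z₃ = 6 − 6 = 0` — the **tight** case: the six rainbow colourings (one edge per copy,
cells `{ab|c, ac|b, bc|a}`, `−1` each) are exactly charged to the three one-colour colourings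
(`{⊤, ⊥, ⊥}`, `+2` each). -/
theorem classSumZ_triangle_top_bot_bot :
    classSumZ triangle 0 1 2 (fun _ => true) (fun _ => false) (fun _ => false) = 0 := by
  decide +kernel

/-- **Lemma C on the triangle, in the kernel**: `Z₃(u, m, v) ≥ 0` for every chain `v ≤ m ≤ u`
of the triangle with marks `0, 1, 2` (64 chains). -/
theorem lemmaC_triangle_chains : ∀ u m v : Config (Fin 3), v ≤ m → m ≤ u →
    0 ≤ classSumZ triangle 0 1 2 u m v := by
  decide +kernel

/-- The body of `LemmaC` at `G = triangle`, marks `0, 1, 2`: settled by the kernel computation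
`lemmaC_triangle_chains` through `classSumZ_cast`. -/
theorem lemmaC_instance_triangle : ∀ u m v : Config (Fin 3), v ≤ m → m ≤ u →
    0 ≤ ∑ φ : ↥(openEdges u \ openEdges v) → Fin 3,
      c007Kernel (triangle.triCell 0 1 2 (tripleCopy v m (openEdges u \ openEdges v) φ 0))
        (triangle.triCell 0 1 2 (tripleCopy v m (openEdges u \ openEdges v) φ 1))
        (triangle.triCell 0 1 2 (tripleCopy v m (openEdges u \ openEdges v) φ 2)) := by
  intro u m v hvm hmu
  rw [← classSumZ_cast]
  exact_mod_cast lemmaC_triangle_chains u m v hvm hmu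

end Examples

end PercRepro
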